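/-
Copyright (c) 2026 the pub-hodgecm-mathlib formalisation cell (harness21).  Prover seat hodgecm-mathlib-K2E1-p06 (g2): Track B «K2-LIT»,
h413 = stmt-HodgeConjecture-24833, chair K2-lead (g0), dealer K2E1-plan (g0) deal 2026-09-03T22:08:37Z; 2026-09-03.
-/
import Literature.NumberTheory.Automorphic.SchurOrthogonalitySupercuspidal
import Literature.NumberTheory.Automorphic.IntegratedOperatorStar
import Literature.NumberTheory.Automorphic.IntegratedOperatorSmoothVectors
import Literature.NumberTheory.Automorphic.SatakeParameterGenericBound
import HarnessLib

/-!
# Crux `H413`, Track B road `K2_E1` «TraceFormulaBeta» — `K2E1SupercuspidalIdempotent`: the normalised matrix coefficient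
# `e = d(ρ) · ⟨ρ(·) u, u⟩` of a supercuspidal representation (compact centre) is a self-adjoint idempotent of `C_c(G)`, and `π(e) ≠ 0`
# detects `ρ` in every unitary representation `π`
(Harish-Chandra (1970), Part I §1 Thm. 1 and §3; Gelbart (1975), §10 p. 153, (10.11) «the functions `f_v = d(σ_v) conj ⟨σ_v(g) u_v, u_v⟩`
… are idempotents»; Rogawski (1990), §12.6 p. 187 and §13.8 p. 218 (i)–(iii) (pseudo-coefficient at `w` in the globalisation))

Cell `hodgecm-mathlib`, crux item h413 = `stmt-HodgeConjecture-24833`, route `HCCMUnconditional`; squad K2, dealer K2E1-plan (g0): «the LOCAL input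
of 5R route S2, composing with rungs 1–3 of K2E1-p07 (g2) ∕ p04 (g2) ∕ p05 (g2)» (live socket `sig_K2E1GlobaliseSquareIntegrableU2R`).  THEOREMS
ONLY (no `def`, no instance, no notation, no named fact, no `sorry`); lane `--supports stmt-HodgeConjecture-24833 --as helper` (count-neutral).

SETTING = the frame of ★ `SchurOrthogonalitySupercuspidal` (Harish-Chandra's Thm. 1 in the SMOOTH category): `G` locally profinite
(`[NonarchimedeanGroup G] [LocallyCompactSpace G] [T2Space G]`, Borel) with COMPACT centre (`hZ`) — the case `G = U(Φ₂)(L⁺_v)` of 5R, whose centre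
`E¹_v` is compact, so no cut-off by `|det|` (★ `SupercuspidalIdempotent`, `GL_n`) is needed; `ρ : Representation ℂ G V` irreducible
(`[ρ.IsIrreducible]`), admissible (`hadm`), SUPERCUSPIDAL (`hsc : ρ.IsSupercuspidal` — the ★ token whose field «smooth matrix coefficients supported in
`C · Z(G)`, `C` compact» gives COMPACT SUPPORT of the coefficients when `Z(G)` is compact: ★ `IsSupercuspidal.hasCompactSupport_sesqForm_apply_apply'`);
`B` a `G`-invariant positive-definite Hermitian form on `V` (`hBsymm`, `hBpos`, `hBinv`; conj-linear in the first slot, `B x y = ⟨x, y⟩`); `ν` a Haar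
measure invariant under inversion (`G` unimodular); `u ≠ 0`.  The test function is the tree's NORMALISED COEFFICIENT (★ `SupercuspidalCoefficientTrace`:
`tr ρ(f_u) = 1`, `tr σ(f_u) = 0` for `σ ≄ ρ`, `f_u(1) = d(ρ) > 0`)

  `e(g) = λ⁻¹ · B (ρ g u) u`,  `λ = (∫ ‖B (ρ x u) u‖² dν) ∕ re B u u`  (`= d(ρ)⁻¹ · B u u`, so `e = d(ρ) conj ⟨u, ρ(·) u⟩ ∕ ⟨u, u⟩`),

carried, as in ★ `IntegratedOperatorStar`, as ANY `e : C_c(G, ℂ)` with these values (`he`); `exists_idempotent` provides one.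

* §1 (the idempotent; (i) Schur orthogonality is ★ BY NAME `Representation.IsSupercuspidal.integral_conj_matrixCoeff_mul_matrixCoeff_eq`):
  `integral_coeff_mul_sesqForm_apply` (`∫ B (ρ g u) u · B x (ρ g u) dν = λ · B x u`), `exists_idempotent`, `mulStar_idempotent` (`e^* = e`),
  `mulConv_idempotent` (**`e ⋆ e = e`**, ★ `mulConv` currency), `integral_idempotent_mul_sesqForm_apply` (`∫ e(g) B x (ρ g u) dν = B x u`),
  `heckeSum_idempotent_eq_self` (**`ρ(e) u = u`** as the finite Hecke sum `Σ_{γ ∈ T} (∫_{γK} e) ρ(γ̃) u = u`, `K = Stab u`).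
* §2 (every unitary strongly continuous `π : ContRepresentation ℂ G H` on a Hilbert space; ★ `integratedOperator`):
  `integratedOperator_idempotent_comp_self`, `adjoint_integratedOperator_idempotent` (**`π(e)` is an orthogonal projection**: `π(e)² = π(e) = π(e)†`,
  ★ `integratedOperator_comp_integratedOperator` ∕ `adjoint_integratedOperator`); `integratedOperator_idempotent_apply_intertwiner` (`π(e)(f u) = f u`
  for every `ρ → π` intertwiner `f`, ★ `integratedOperator_apply_eq_sum_of_intertwines`); `exists_intertwiner_of_integratedOperator_idempotent_ne_zero`
  (`π(e) w ≠ 0` ⇒ `x ↦ π(B (ρ · u) x) w` is a NON-ZERO intertwiner, ★ `apply_comp_integratedOperator`); and the detection theorem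
  **`integratedOperator_idempotent_ne_zero_iff`: `π(e) ≠ 0 ↔ ∃ f : V →ₗ[ℂ] H, f ≠ 0 ∧ ∀ g x, f (ρ g x) = π g (f x)`** — the witness shape of
  ★ `HasLocalComponentAt` ∕ the local-component tokens behind ★ `cmOccursInDiscreteSpectrum` (injectivity of `f`: ★ `injective_of_isIrreducible_of_intertwines`).

HONEST LABEL.  Local input only; closes no socket; `HC_CM` is proved only modulo the 7 printed citations (2 remaining named inputs: hLiu418 =
`stmt-HodgeConjecture-24832`, h413 = `stmt-HodgeConjecture-24833`) until rung 0 closes.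

## References
* [HarishChandra1970] Harish-Chandra (notes by G. van Dijk), *Harmonic analysis on reductive p-adic groups*, LNM 162 (1970), Part I §1 Thm. 1, §3.
* [Gelbart1975] S. Gelbart, *Automorphic forms on adele groups*, Ann. of Math. Stud. 83 (1975), §10 p. 153, (10.11).
* [Rogawski1990] J. D. Rogawski, *Automorphic Representations of Unitary Groups in Three Variables*, Ann. of Math. Stud. 123 (1990), §12.6 p. 187,
  §13.8 p. 218.
* [DeitmarEchterhoff2014] A. Deitmar, S. Echterhoff, *Principles of Harmonic Analysis*, 2nd ed. (2014), Prop. 6.2.1.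
-/

set_option autoImplicit false
set_option linter.dupNamespace false

noncomputable section

open MeasureTheory Filter Topology CompactlySupported
open scoped ComplexConjugate InnerProductSpace
open Literature.NumberTheory.Automorphic Representation

namespace Summit.HodgeConjecture.HodgeConjecture.Cruxes.H413.K2E1SupercuspidalIdempotent

variable {G V : Type*} [Group G] [TopologicalSpace G] [NonarchimedeanGroup G] [LocallyCompactSpace G] [T2Space G]
  [MeasurableSpace G] [BorelSpace G] [AddCommGroup V] [Module ℂ V] {ρ : Representation ℂ G V} {B : V →ₗ⋆[ℂ] V →ₗ[ℂ] ℂ}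

/-! ## §1 The normalised coefficient is a self-adjoint idempotent with `ρ(e) u = u` -/

section Idempotent

variable [ρ.IsIrreducible] (hadm : ρ.IsAdmissible) (hsc : ρ.IsSupercuspidal) (hZ : IsCompact (Subgroup.center G : Set G))
  (hBsymm : B.IsSymm) (hBpos : ∀ v : V, v ≠ 0 → 0 < (B v v).re) (hBinv : ∀ (g : G) (v w : V), B (ρ g v) (ρ g w) = B v w)
  (ν : Measure G) [ν.IsHaarMeasure] [ν.IsInvInvariant] {u : V} (hu : u ≠ 0)

include hadm hsc hZ hBsymm hBpos hBinv hu in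
/-- **`∫ B (ρ g u) u · B x (ρ g u) dν(g) = λ · B x u`**, `λ = (∫ ‖B (ρ x u) u‖² dν) ∕ re B u u` — Schur orthogonality ★
`IsSupercuspidal.integral_conj_matrixCoeff_mul_matrixCoeff_eq` at `(a, b, c, e, v₀) = (u, u, u, x, u)` (`B (ρ g u) u = conj (B u (ρ g u))`), with
`κ · B u u = λ` since `B u u` is real. [cite: HarishChandra1970, Part I §1 Theorem 1 (a)] -/
theorem integral_coeff_mul_sesqForm_apply (x : V) :
    ∫ g, B (ρ g u) u * B x (ρ g u) ∂ν = ((((∫ y, ‖B (ρ y u) u‖ ^ 2 ∂ν) / (B u u).re : ℝ) : ℂ)) * B x u := by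
  set r : ℝ := (B u u).re with hr
  have h := hsc.integral_conj_matrixCoeff_mul_matrixCoeff_eq hadm hZ hBsymm hBpos hBinv ν hu u u u x
  rw [← hr] at h
  have h1 : (fun g => B (ρ g u) u * B x (ρ g u)) = fun g => conj (B u (ρ g u)) * B x (ρ g u) := by
    funext g
    rw [hBsymm.eq u (ρ g u)]
  rw [h1, h]
  have hβ : (B u u : ℂ) = (r : ℂ) := (Complex.conj_eq_iff_re.1 (hBsymm.eq u u)).symm
  have hr0 : (r : ℂ) ≠ 0 := by exact_mod_cast (hBpos u hu).ne'
  rw [hβ, Complex.ofReal_div, Complex.ofReal_div, Complex.ofReal_pow]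
  field_simp

include hsc hZ hBsymm hBpos hBinv hu in
omit [LocallyCompactSpace G] [T2Space G] [ρ.IsIrreducible] [ν.IsInvInvariant] in
/-- The normalisation `λ = (∫ ‖B (ρ x u) u‖² dν) ∕ re B u u` is positive (★ `integral_norm_sq_sesqForm_pos`, `hBpos`). [cite: HarishChandra1970, Part I §1 Theorem 1 (a)] -/
theorem normalisation_pos (hsm : ρ.IsSmooth) : 0 < (∫ y, ‖B (ρ y u) u‖ ^ 2 ∂ν) / (B u u).re :=
  div_pos (hsc.integral_norm_sq_sesqForm_pos hZ hsm hBsymm hBpos hBinv ν hu) (hBpos u hu)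

include hsc hZ hBsymm hBinv in
omit [LocallyCompactSpace G] [T2Space G] [BorelSpace G] [ρ.IsIrreducible] [ν.IsHaarMeasure] [ν.IsInvInvariant] in
/-- **The normalised coefficient is a test function**: there is `e ∈ C_c(G, ℂ)` with `e(g) = λ⁻¹ · B (ρ g u) u` (continuous: ★
`continuous_sesqForm_apply_apply'`; compactly supported because `ρ` is supercuspidal and `Z(G)` compact: ★
`IsSupercuspidal.hasCompactSupport_sesqForm_apply_apply'`). [cite: HarishChandra1970, Part I §3] -/
theorem exists_idempotent (hsm : ρ.IsSmooth) (u : V) :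
    ∃ e : C_c(G, ℂ), ∀ g, e g = ((((∫ y, ‖B (ρ y u) u‖ ^ 2 ∂ν) / (B u u).re : ℝ) : ℂ))⁻¹ * B (ρ g u) u :=
  ⟨⟨⟨fun g => ((((∫ y, ‖B (ρ y u) u‖ ^ 2 ∂ν) / (B u u).re : ℝ) : ℂ))⁻¹ * B (ρ g u) u,
      continuous_const.mul (continuous_sesqForm_apply_apply' hBsymm (hsm u) u)⟩,
    (hsc.hasCompactSupport_sesqForm_apply_apply' hZ hsm hBinv u u).mul_left⟩, fun _ => rfl⟩

variable (e : C_c(G, ℂ)) (he : ∀ g, e g = ((((∫ y, ‖B (ρ y u) u‖ ^ 2 ∂ν) / (B u u).re : ℝ) : ℂ))⁻¹ * B (ρ g u) u)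

include hBsymm hBinv he in
omit [ρ.IsIrreducible] [NonarchimedeanGroup G] [LocallyCompactSpace G] [T2Space G] [BorelSpace G] [ν.IsHaarMeasure] [ν.IsInvInvariant] in
/-- **`e^* = e`**: `conj e(g⁻¹) = λ⁻¹ · B u (ρ g⁻¹ u) = λ⁻¹ · B (ρ g u) u` (Hermitian symmetry, invariance, `λ` real). [cite: Gelbart1975, §10 (10.11)] -/
theorem mulStar_idempotent (g : G) : mulStar (⇑e) g = e g := by
  rw [mulStar_apply, he, he, map_mul, map_inv₀, Complex.conj_ofReal, hBsymm.eq, ← hBinv g u (ρ g⁻¹ u), self_inv_apply]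

include hadm hsc hZ hBsymm hBpos hBinv hu he in
/-- **`∫ e(g) · B x (ρ g u) dν(g) = B x u`** for every `x ∈ V` — the weak form of `ρ(e) u = u` (Schur orthogonality and the normalisation).
[cite: HarishChandra1970, Part I §1 Theorem 1 (a)] -/
theorem integral_idempotent_mul_sesqForm_apply (x : V) : ∫ g, e g * B x (ρ g u) ∂ν = B x u := by
  have h1 : (fun g => e g * B x (ρ g u)) =
      fun g => ((((∫ y, ‖B (ρ y u) u‖ ^ 2 ∂ν) / (B u u).re : ℝ) : ℂ))⁻¹ * (B (ρ g u) u * B x (ρ g u)) := by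
    funext g
    rw [he, mul_assoc]
  have hl0 : ((((∫ y, ‖B (ρ y u) u‖ ^ 2 ∂ν) / (B u u).re : ℝ) : ℂ)) ≠ 0 := by
    exact_mod_cast (normalisation_pos hsc hZ hBsymm hBpos hBinv ν hu hadm.isSmooth).ne'
  rw [h1, integral_const_mul, integral_coeff_mul_sesqForm_apply hadm hsc hZ hBsymm hBpos hBinv ν hu x, ← mul_assoc,
    inv_mul_cancel₀ hl0, one_mul]

include hadm hsc hZ hBsymm hBpos hBinv hu he in
/-- **`e ⋆ e = e`** in the tree's convolution `mulConv ν e e (g) = ∫ e(x) e(x⁻¹ g) dν(x)` (Gelbart (1975), (10.11): «these functions are idempotents»):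
`e(x⁻¹ g) = λ⁻¹ B (ρ g u) (ρ x u)` by invariance, and `∫ B (ρ x u) u · B (ρ g u) (ρ x u) dν(x) = λ · B (ρ g u) u` is
`integral_coeff_mul_sesqForm_apply` at `x = ρ g u`. [cite: Gelbart1975, §10 (10.11)] [cite: HarishChandra1970, Part I §1 Theorem 1 (a)] -/
theorem mulConv_idempotent (g : G) : mulConv ν (⇑e) (⇑e) g = e g := by
  rw [mulConv_apply]
  have h1 : (fun x => e x * e (x⁻¹ * g)) = fun x => (((((∫ y, ‖B (ρ y u) u‖ ^ 2 ∂ν) / (B u u).re : ℝ) : ℂ))⁻¹ *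
      ((((∫ y, ‖B (ρ y u) u‖ ^ 2 ∂ν) / (B u u).re : ℝ) : ℂ))⁻¹) * (B (ρ x u) u * B (ρ g u) (ρ x u)) := by
    funext x
    rw [he, he, map_mul, Module.End.mul_apply, ← hBinv x (ρ x⁻¹ (ρ g u)) u, self_inv_apply]
    ring
  have hl0 : ((((∫ y, ‖B (ρ y u) u‖ ^ 2 ∂ν) / (B u u).re : ℝ) : ℂ)) ≠ 0 := by
    exact_mod_cast (normalisation_pos hsc hZ hBsymm hBpos hBinv ν hu hadm.isSmooth).ne'
  rw [h1, integral_const_mul, integral_coeff_mul_sesqForm_apply hadm hsc hZ hBsymm hBpos hBinv ν hu (ρ g u), he]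
  field_simp

include hadm hsc hZ hBsymm hBpos hBinv hu he in
/-- **`ρ(e) u = u`** as the finite Hecke sum the tree uses for the action of `C_c(G)` on smooth vectors (★ `IntegratedOperatorSmoothVectors`): for
`K = Stab_ρ(u)` (open: `u` is smooth) and every finite set `T` of cosets `γ K` covering the support of `e`,
`Σ_{γ ∈ T} (∫_{γK} e dν) • ρ(γ̃) u = u`.  Proof: pair with `B y`, unfold the sum to `∫ e(g) · B y (ρ g u) dν = B y u` (★
`integral_smul_eq_sum_setIntegral_smul`, `integral_idempotent_mul_sesqForm_apply`), and use definiteness of `B`. [cite: Gelbart1975, §10 (10.11)] -/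
theorem heckeSum_idempotent_eq_self {T : Finset (G ⧸ ρ.stabilizerSubgroup u)}
    (hT : tsupport (⇑e) ⊆ ⋃ γ ∈ T, {g : G | (g : G ⧸ ρ.stabilizerSubgroup u) = γ}) :
    ∑ γ ∈ T, (∫ g in {g : G | (g : G ⧸ ρ.stabilizerSubgroup u) = γ}, e g ∂ν) • ρ γ.out u = u := by
  have hK : IsOpen (ρ.stabilizerSubgroup u : Set G) := hadm.isSmooth u
  -- pairing with `B y` unfolds the Hecke sum back to the integral
  have hpair : ∀ y : V, B y (∑ γ ∈ T, (∫ g in {g : G | (g : G ⧸ ρ.stabilizerSubgroup u) = γ}, e g ∂ν) • ρ γ.out u) = B y u := by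
    intro y
    rw [map_sum]
    simp_rw [map_smul, smul_eq_mul]
    have hF : ∀ x : G, ∀ k ∈ ρ.stabilizerSubgroup u, B y (ρ (x * k) u) = B y (ρ x u) := fun x k hk => by
      rw [map_mul, Module.End.mul_apply, (ρ.mem_stabilizerSubgroup u k).1 hk]
    have h := integral_smul_eq_sum_setIntegral_smul (μ := ν) (E := ℂ) hK (F := fun g => B y (ρ g u)) hF (φ := ⇑e)
      e.continuous e.hasCompactSupport hT
    simp_rw [smul_eq_mul] at h
    rw [← h, integral_idempotent_mul_sesqForm_apply hadm hsc hZ hBsymm hBpos hBinv ν hu e he y]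
  -- definiteness of `B`
  set S := ∑ γ ∈ T, (∫ g in {g : G | (g : G ⧸ ρ.stabilizerSubgroup u) = γ}, e g ∂ν) • ρ γ.out u with hS
  have h0 : B (S - u) (S - u) = 0 := by
    rw [map_sub (B (S - u)), hpair (S - u), sub_self]
  exact sub_eq_zero.1 (eq_zero_of_sesqForm_self_eq_zero hBpos (S - u) h0)

end Idempotent

/-! ## §2 `π(e)` is an orthogonal projection detecting `ρ` in every unitary representation -/

section Unitary

variable [ρ.IsIrreducible] (hadm : ρ.IsAdmissible) (hsc : ρ.IsSupercuspidal) (hZ : IsCompact (Subgroup.center G : Set G))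
  (hBsymm : B.IsSymm) (hBpos : ∀ v : V, v ≠ 0 → 0 < (B v v).re) (hBinv : ∀ (g : G) (v w : V), B (ρ g v) (ρ g w) = B v w)
  (ν : Measure G) [ν.IsHaarMeasure] [ν.IsInvInvariant] {u : V} (hu : u ≠ 0)
  (e : C_c(G, ℂ)) (he : ∀ g, e g = ((((∫ y, ‖B (ρ y u) u‖ ^ 2 ∂ν) / (B u u).re : ℝ) : ℂ))⁻¹ * B (ρ g u) u)
  {H : Type*} [NormedAddCommGroup H] [InnerProductSpace ℂ H] [CompleteSpace H] {π : ContRepresentation ℂ G H}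
  (hπu : π.IsUnitary) (hπc : π.IsStronglyContinuous)

include hadm hsc hZ hBsymm hBpos hBinv hu he in
/-- **`π(e) ∘ π(e) = π(e)`** for every unitary strongly continuous `π` (★ `integratedOperator_comp_integratedOperator`: `π(e) π(e) = π(e ⋆ e)`, and
`e ⋆ e = e`). [cite: DeitmarEchterhoff2014, Prop. 6.2.1] [cite: Gelbart1975, §10 (10.11)] -/
theorem integratedOperator_idempotent_comp_self [SecondCountableTopology G] [SFinite ν] :
    π.integratedOperator hπu hπc ν e ∘L π.integratedOperator hπu hπc ν e = π.integratedOperator hπu hπc ν e :=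
  ContRepresentation.integratedOperator_comp_integratedOperator hπu hπc ν e e e
    fun x => (mulConv_idempotent hadm hsc hZ hBsymm hBpos hBinv ν hu e he x).symm

include hBsymm hBinv he in
omit [ρ.IsIrreducible] [NonarchimedeanGroup G] [LocallyCompactSpace G] [T2Space G] in
/-- **`π(e)† = π(e)`** (★ `adjoint_integratedOperator`: `π(e)^* = π(e^*)`, and `e^* = e`). [cite: DeitmarEchterhoff2014, Prop. 6.2.1] -/
theorem adjoint_integratedOperator_idempotent [IsTopologicalGroup G] :
    ContinuousLinearMap.adjoint (π.integratedOperator hπu hπc ν e) = π.integratedOperator hπu hπc ν e :=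
  ContRepresentation.adjoint_integratedOperator hπu hπc ν e e fun x => (mulStar_idempotent hBsymm hBinv ν e he x).symm

include hadm hsc hZ hBsymm hBpos hBinv hu he in
/-- **`π(e)(f u) = f u`** for every linear `f : V → H` intertwining `ρ` with `π` (★ `integratedOperator_apply_eq_sum_of_intertwines`: `π(e)(f u)` is
`f` of the Hecke sum, which is `u` by `heckeSum_idempotent_eq_self`) — `π(e)` fixes the image of `u` under every embedding of `ρ`.
[cite: Gelbart1975, §10 (10.11)–(10.12)] -/
theorem integratedOperator_idempotent_apply_intertwiner (f : V →ₗ[ℂ] H) (hf : ∀ (g : G) (x : V), f (ρ g x) = π g (f x)) :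
    π.integratedOperator hπu hπc ν e (f u) = f u := by
  obtain ⟨T, hT⟩ := exists_finset_tsupport_subset_biUnion_coset (ρ.stabilizerSubgroup u) (hadm.isSmooth u) e.hasCompactSupport
  rw [ContRepresentation.integratedOperator_apply_eq_sum_of_intertwines hπu hπc ν f hf (hadm.isSmooth u) e hT,
    heckeSum_idempotent_eq_self hadm hsc hZ hBsymm hBpos hBinv ν hu e he hT]

include hadm hsc hZ hBsymm hBinv he in
omit [LocallyCompactSpace G] [T2Space G] [ρ.IsIrreducible] [ν.IsInvInvariant] in
/-- **`π(e) w ≠ 0` forces an embedding `ρ ↪ π`**: `T_w x := π(c_x) w`, `c_x(g) = B (ρ g u) x ∈ C_c(G)` (a coefficient of the supercuspidal `ρ`,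
compact centre), is linear in `x` (★ `integratedOperator_add/_smul`), intertwines — `c_{ρ(h)x} = c_x(h⁻¹ ·)` by invariance, and
`π(h) π(c_x) = π(c_x(h⁻¹ ·))` (★ `apply_comp_integratedOperator`) — and `π(e) w = λ⁻¹ T_w u`, so `T_w ≠ 0`.  (Deitmar–Echterhoff (2014), Prop. 6.2.1;
the converse of Gelbart's «`R(ξ)` cuts out the constituents with `π_v ≅ σ_v`».) [cite: DeitmarEchterhoff2014, Prop. 6.2.1] [cite: Gelbart1975, §10 p. 153] -/
theorem exists_intertwiner_of_integratedOperator_idempotent_apply_ne_zero {w : H} (hw : π.integratedOperator hπu hπc ν e w ≠ 0) :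
    ∃ f : V →ₗ[ℂ] H, f u ≠ 0 ∧ ∀ (g : G) (x : V), f (ρ g x) = π g (f x) := by
  have hsm := hadm.isSmooth
  -- the coefficients `c_x(g) = B (ρ g u) x` as test functions
  let c : V → C_c(G, ℂ) := fun x =>
    ⟨⟨fun g => B (ρ g u) x, continuous_sesqForm_apply_apply' hBsymm (hsm u) x⟩, hsc.hasCompactSupport_sesqForm_apply_apply' hZ hsm hBinv u x⟩
  have hc : ∀ x g, c x g = B (ρ g u) x := fun _ _ => rfl
  have hadd : ∀ x y, c (x + y) = c x + c y := fun x y => by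
    ext g
    simp only [hc, CompactlySupportedContinuousMap.coe_add, Pi.add_apply, map_add]
  have hsmul : ∀ (a : ℂ) x, c (a • x) = a • c x := fun a x => by
    ext g
    simp only [hc, CompactlySupportedContinuousMap.coe_smul, Pi.smul_apply, map_smul, smul_eq_mul]
  let f : V →ₗ[ℂ] H :=
    { toFun := fun x => π.integratedOperator hπu hπc ν (c x) w
      map_add' := fun x y => by
        simp only [hadd, ContRepresentation.integratedOperator_add]
        rfl
      map_smul' := fun a x => by
        simp only [hsmul, ContRepresentation.integratedOperator_smul]
        rfl }
  have hf : ∀ x, f x = π.integratedOperator hπu hπc ν (c x) w := fun _ => rfl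
  refine ⟨f, ?_, fun h x => ?_⟩
  · -- `π(e) w = λ⁻¹ • f u`
    have hecu : e = ((((∫ y, ‖B (ρ y u) u‖ ^ 2 ∂ν) / (B u u).re : ℝ) : ℂ))⁻¹ • c u := by
      ext g
      rw [CompactlySupportedContinuousMap.coe_smul, Pi.smul_apply, smul_eq_mul, hc, he]
    intro h0
    apply hw
    rw [hecu, ContRepresentation.integratedOperator_smul]
    change ((((∫ y, ‖B (ρ y u) u‖ ^ 2 ∂ν) / (B u u).re : ℝ) : ℂ))⁻¹ • π.integratedOperator hπu hπc ν (c u) w = 0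
    rw [← hf, h0, smul_zero]
  · -- equivariance
    have hch : ∀ y, c (ρ h x) y = c x (h⁻¹ * y) := fun y => by
      rw [hc, hc, map_mul, Module.End.mul_apply, ← hBinv h⁻¹ (ρ y u) (ρ h x), inv_self_apply]
    rw [hf, hf, ← ContRepresentation.apply_comp_integratedOperator hπu hπc ν h (c x) (c (ρ h x)) hch, ContinuousLinearMap.comp_apply]

include hadm hsc hZ hBsymm hBpos hBinv hu he in
/-- **DETECTION: `π(e) ≠ 0 ↔ ρ` embeds in `π`** — for every unitary strongly continuous representation `π` of `G` on a Hilbert space,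
`π(e) ≠ 0` iff there is a NON-ZERO linear `f : V → H` with `f (ρ g x) = π g (f x)` (the witness shape of ★ `HasLocalComponentAt`; such an `f` is
injective, `ρ` being irreducible — ★ `injective_of_isIrreducible_of_intertwines` — and then `π(e)(f u) = f u ≠ 0` by
`integratedOperator_idempotent_apply_intertwiner`).  Contrapositive: the range of the projection `π(e)` is `{0}` unless `ρ` embeds in `π`
(Gelbart (1975), §10 p. 153: «`R(ξ)` is zero on the constituents `π^j` with `π^j_v ≇ σ_v`»). [cite: Gelbart1975, §10 p. 153] [cite: HarishChandra1970, Part I §1 Theorem 1] -/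
theorem integratedOperator_idempotent_ne_zero_iff :
    π.integratedOperator hπu hπc ν e ≠ 0 ↔ ∃ f : V →ₗ[ℂ] H, f ≠ 0 ∧ ∀ (g : G) (x : V), f (ρ g x) = π g (f x) := by
  constructor
  · intro hne
    obtain ⟨w, hw⟩ : ∃ w, π.integratedOperator hπu hπc ν e w ≠ 0 := by
      by_contra h
      refine hne (ContinuousLinearMap.ext fun w => ?_)
      rw [not_not.1 (not_exists.1 h w)]
      rfl
    obtain ⟨f, hfu, hf⟩ := exists_intertwiner_of_integratedOperator_idempotent_apply_ne_zero hadm hsc hZ hBsymm hBinv ν e he hπu hπc hw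
    exact ⟨f, fun h0 => hfu (by rw [h0, LinearMap.zero_apply]), hf⟩
  · rintro ⟨f, hf0, hf⟩ h0
    let σ : G →* (H →ₗ[ℂ] H) :=
      { toFun := fun g => ((π g : H →L[ℂ] H) : H →ₗ[ℂ] H)
        map_one' := by
          rw [map_one]
          rfl
        map_mul' := fun a b => by
          rw [map_mul]
          rfl }
    have hinj : Function.Injective f := injective_of_isIrreducible_of_intertwines (inferInstance : ρ.IsIrreducible) σ hf0 fun g x => hf g x
    have h1 := integratedOperator_idempotent_apply_intertwiner hadm hsc hZ hBsymm hBpos hBinv ν hu e he hπu hπc f hf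
    rw [h0] at h1
    exact hu (hinj (by rw [map_zero]; exact h1.symm.trans rfl))

end Unitary

end Summit.HodgeConjecture.HodgeConjecture.Cruxes.H413.K2E1SupercuspidalIdempotent

end
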